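import Literature.NumberTheory.LFunctions.NymanBeurlingRateReduction
import Literature.NumberTheory.LFunctions.NymanBeurlingMoebiusSum
import Literature.NumberTheory.LFunctions.MertensBoundRH
import Mathlib.NumberTheory.AbelSummation
import HarnessLib

/-!
# Balazard–de Roton 2010, eq. (t61) and Proposition 11: the tail of `∑ μ(n)n^{-s}` under RH by
# partial summation from `M(x)` and the twisted sums `M_N(iτ)`

Topic `Literature/NumberTheory/LFunctions`; a brick of the proof of Balazard–de Roton 2010,
Théorème 1 (`Literature.NumberTheory.LFunctions.BalazardDeRoton2010_thm1`, `NymanBeurlingRate.lean`).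
M. Balazard, A. de Roton, *Sur un critère de Báez-Duarte pour l'hypothèse de Riemann*, Int. J.
Number Theory 6 (2010) 883–903 = arXiv:0812.1689, §6:

* **(t61)** (§6.3): for `N ≥ 1`, `ε > 0`, `τ ∈ ℝ` (under RH),
  `ζ(s+ε)^{-1} − M_N(s+ε) = −M_N(iτ)N^{-1/2−ε} + (1/2+ε)∫_N^∞ t^{-3/2−ε} M_t(iτ) dt`,
  where `M_t(iτ) = ∑_{n≤t} μ(n)n^{-iτ}` (`= moebiusSum ⌊t⌋ (iτ)`) — Abel summation of the tail of
  the (under RH convergent) Dirichlet series `∑ μ(n)n^{-1/2-ε-iτ} = 1/ζ(1/2+ε+iτ)`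
  (`inv_zeta_sub_moebiusSum_eq`);
* **Proposition 11** ("La démonstration (standard) est laissée au lecteur"): if
  `|M(x)| ≤ C√x G(x)` for `x ≥ 1` with `G ≥ 0` non-decreasing, then
  `|M_N(iτ)| ≤ 3C(1+|τ|)√N G(N)` (`norm_moebiusSum_twist_le_of_mertens`; the paper's case is
  `G(x) = exp((log x)^{1/2}(log log x)^{5/2+δ})`, Soundararajan's bound under RH, which is NOT
  proved here — it is the deep input of the whole argument);
* the RH-consequence actually needed for the convergence in (t61): `|M_N(iτ)| ≤ C(1+|τ|)N^{1/2+η}`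
  (`exists_norm_moebiusSum_twist_le_of_RH`, from the tree's `M(x) = O(x^{1/2+η})`,
  `MertensBoundRH.mertens_isBigO_of_riemannHypothesis`, and Prop. 11's partial summation
  `norm_moebiusSum_twist_le`: `|M_N(iτ)| ≤ |M(N)| + |τ|∫_1^N |M(t)| dt/t`).

## References

* [BalazardDeRoton2010] M. Balazard, A. de Roton, Int. J. Number Theory 6 (2010) 883–903, §6.1
  Prop. 11, §6.3 eq. (t61) (arXiv:0812.1689 pp. 7, 9).
* [Titchmarsh1986] E. C. Titchmarsh, *The Theory of the Riemann Zeta-Function*, Thm. 14.25 (A).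
-/

noncomputable section

open Complex Filter Topology Set MeasureTheory Real Finset

namespace Literature.NumberTheory.LFunctions

namespace BalazardDeRoton

open BaezDuarteOnlyIf (moebiusSum)
open ArithmeticFunction (moebius)

/-! ## The twisted sums `M_X(iτ) = ∑_{n≤X} μ(n) n^{-iτ} = moebiusSum X (iτ)` -/

/-- `∑_{k=0}^{X} μ(k) = M(X)` (the `k = 0` term vanishes). [folklore] -/
lemma sum_Icc_moebius_eq_mertens (X : ℕ) :
    ∑ k ∈ Icc 0 X, (moebius k : ℂ) = (mertensFunction X : ℂ) := by
  rw [mertensFunction, Nat.floor_natCast, Icc_eq_cons_Ioc (Nat.zero_le X), sum_cons]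
  simp

/-- `∑_{k=0}^{X} μ(k) k^{-iτ} = M_X(iτ) = moebiusSum X (iτ)`. [folklore] -/
lemma sum_Icc_moebius_twist_eq (X : ℕ) (τ : ℝ) :
    ∑ k ∈ Icc 0 X, (moebius k : ℂ) * (k : ℂ) ^ (-((τ : ℂ) * I)) = moebiusSum X (τ * I) := by
  rw [Icc_eq_cons_Ioc (Nat.zero_le X), sum_cons]
  simp only [ArithmeticFunction.map_zero, Int.cast_zero, zero_mul, zero_add]
  unfold moebiusSum
  refine Finset.sum_congr rfl fun k hk ↦ ?_
  rw [Finset.mem_Icc] at hk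
  rw [div_eq_mul_inv, ← cpow_neg]

/-- `M(t)` for real `t ≥ 0` in terms of the natural sums: `∑_{k=0}^{⌊t⌋} μ(k) = M(t)`. [folklore] -/
lemma sum_Icc_floor_moebius_eq_mertens (t : ℝ) :
    ∑ k ∈ Icc 0 ⌊t⌋₊, (moebius k : ℂ) = (mertensFunction t : ℂ) := by
  rw [mertensFunction, Icc_eq_cons_Ioc (Nat.zero_le _), sum_cons]
  simp

/-- `|M(t)| ≤ t` for `t ≥ 0`. [folklore] -/
lemma abs_mertens_le {t : ℝ} (ht : 0 ≤ t) : |(mertensFunction t : ℝ)| ≤ t := by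
  unfold mertensFunction
  calc |((∑ n ∈ Ioc 0 ⌊t⌋₊, moebius n : ℤ) : ℝ)| = |∑ n ∈ Ioc 0 ⌊t⌋₊, (moebius n : ℝ)| := by
        push_cast; rfl
    _ ≤ ∑ n ∈ Ioc 0 ⌊t⌋₊, |(moebius n : ℝ)| := Finset.abs_sum_le_sum_abs _ _
    _ ≤ ∑ n ∈ Ioc 0 ⌊t⌋₊, (1 : ℝ) := Finset.sum_le_sum fun n _ ↦ by
        exact_mod_cast ArithmeticFunction.abs_moebius_le_one
    _ = ⌊t⌋₊ := by simp
    _ ≤ t := Nat.floor_le ht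

/-- The derivative of `t ↦ t^{r}` (`t` real, `r` complex, `t > 0`, `r ≠ 0`) as a `deriv`. [folklore] -/
lemma deriv_ofReal_cpow {t : ℝ} (ht : 0 < t) {r : ℂ} (hr : r ≠ 0) :
    deriv (fun y : ℝ ↦ (y : ℂ) ^ r) t = r * (t : ℂ) ^ (r - 1) :=
  (hasDerivAt_ofReal_cpow_const ht.ne' hr).deriv

/-- `M(⌊t⌋) = M(t)`. [folklore] -/
lemma mertens_floor (t : ℝ) : mertensFunction (⌊t⌋₊ : ℝ) = mertensFunction t := by
  unfold mertensFunction; rw [Nat.floor_natCast]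

/-- **Abel summation for the twisted sums**: for `X ≥ 1` and `r ≠ 0`,
`M_X` twisted by `k^r`: `∑_{k≤X} μ(k) k^{r} = X^{r} M(X) − ∫_1^X r t^{r−1} M(t) dt`. [folklore] -/
lemma moebius_twist_abel {X : ℕ} (hX : 1 ≤ X) {r : ℂ} (hr : r ≠ 0) :
    ∑ k ∈ Icc 1 X, (moebius k : ℂ) * ((k : ℝ) : ℂ) ^ r =
      ((X : ℝ) : ℂ) ^ r * (mertensFunction X : ℂ) -
        ∫ t in Set.Ioc (1 : ℝ) X, r * (t : ℂ) ^ (r - 1) * (mertensFunction t : ℂ) := by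
  have hdiff : ∀ t ∈ Set.Icc ((1 : ℕ) : ℝ) ((X : ℕ) : ℝ),
      DifferentiableAt ℝ (fun y : ℝ ↦ (y : ℂ) ^ r) t := fun t ht ↦
    (hasDerivAt_ofReal_cpow_const (by rw [Nat.cast_one] at ht; linarith [ht.1]) hr).differentiableAt
  have hderiv_eq : ∀ t ∈ Set.Icc ((1 : ℕ) : ℝ) ((X : ℕ) : ℝ), deriv (fun y : ℝ ↦ (y : ℂ) ^ r) t =
      r * (t : ℂ) ^ (r - 1) := fun t ht ↦
    deriv_ofReal_cpow (by rw [Nat.cast_one] at ht; linarith [ht.1]) hr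
  have hcont : ContinuousOn (fun t : ℝ ↦ r * (t : ℂ) ^ (r - 1)) (Set.Icc ((1 : ℕ) : ℝ) ((X : ℕ) : ℝ)) := by
    refine continuousOn_const.mul (ContinuousOn.cpow_const (by fun_prop) fun t ht ↦ ?_)
    rw [Nat.cast_one] at ht
    exact Or.inl (by simp; linarith [ht.1])
  have hint : IntegrableOn (deriv (fun y : ℝ ↦ (y : ℂ) ^ r)) (Set.Icc ((1 : ℕ) : ℝ) ((X : ℕ) : ℝ)) :=
    (hcont.integrableOn_Icc).congr_fun (fun t ht ↦ (hderiv_eq t ht).symm) measurableSet_Icc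
  have habel := sum_mul_eq_sub_sub_integral_mul' (fun k ↦ (moebius k : ℂ)) hX hdiff hint
  rw [sum_Icc_moebius_eq_mertens, sum_Icc_moebius_eq_mertens] at habel
  have hM1 : (mertensFunction ((1 : ℕ) : ℝ) : ℂ) = 1 := by
    rw [mertensFunction]; simp
  rw [hM1] at habel
  simp only [Nat.cast_one, ofReal_one, one_cpow, mul_one] at habel
  -- `∑_{Icc 1 X} = μ(1)·1^r + ∑_{Ioc 1 X}`
  rw [Icc_eq_cons_Ioc hX, sum_cons]
  simp only [Nat.cast_one, ArithmeticFunction.moebius_apply_one, Int.cast_one, ofReal_one,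
    one_cpow, mul_one]
  have hcomm : ∑ k ∈ Ioc 1 X, (moebius k : ℂ) * ((k : ℝ) : ℂ) ^ r =
      ∑ k ∈ Ioc 1 X, ((k : ℝ) : ℂ) ^ r * (moebius k : ℂ) :=
    Finset.sum_congr rfl fun k _ ↦ mul_comm _ _
  rw [hcomm, habel]
  -- the integrand: `deriv f t · M(⌊t⌋) = r t^{r-1} M(t)` on `Ioc 1 X`
  have hI : ∫ t in Set.Ioc (1 : ℝ) X, deriv (fun y : ℝ ↦ (y : ℂ) ^ r) t *
        ∑ k ∈ Icc 0 ⌊t⌋₊, (moebius k : ℂ) =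
      ∫ t in Set.Ioc (1 : ℝ) X, r * (t : ℂ) ^ (r - 1) * (mertensFunction t : ℂ) := by
    refine setIntegral_congr_fun measurableSet_Ioc fun t ht ↦ ?_
    rw [sum_Icc_floor_moebius_eq_mertens, deriv_ofReal_cpow (by linarith [ht.1]) hr]
  rw [hI]
  ring

/-- **Partial summation for the twisted sums** (the "standard" step of Prop. 11): for `X ≥ 1`,
`|M_X(iτ)| ≤ |M(X)| + |τ| ∫_1^X |M(t)| dt/t`. [cite: BalazardDeRoton2010, Prop. 11] -/
theorem norm_moebiusSum_twist_le {X : ℕ} (hX : 1 ≤ X) (τ : ℝ) :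
    ‖moebiusSum X (τ * I)‖ ≤ |(mertensFunction X : ℝ)| +
      |τ| * ∫ t in Set.Icc (1 : ℝ) X, |(mertensFunction t : ℝ)| / t := by
  have hint0 : 0 ≤ |τ| * ∫ t in Set.Icc (1 : ℝ) X, |(mertensFunction t : ℝ)| / t :=
    mul_nonneg (abs_nonneg _) (setIntegral_nonneg measurableSet_Icc fun t ht ↦
      div_nonneg (abs_nonneg _) (by linarith [ht.1]))
  -- `moebiusSum X (iτ) = ∑ μ(k) k^{r}`, `r = −iτ`
  set r : ℂ := -((τ : ℂ) * I) with hr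
  have hsum : moebiusSum X (τ * I) = ∑ k ∈ Icc 1 X, (moebius k : ℂ) * ((k : ℝ) : ℂ) ^ r := by
    unfold moebiusSum
    refine Finset.sum_congr rfl fun k _ ↦ ?_
    rw [div_eq_mul_inv, ← cpow_neg, Complex.ofReal_natCast]
  rcases eq_or_ne τ 0 with hτ | hτ
  · -- `τ = 0`
    have h0 : moebiusSum X (τ * I) = (mertensFunction X : ℂ) := by
      rw [hsum, ← sum_Icc_moebius_eq_mertens, Icc_eq_cons_Ioc (Nat.zero_le X), sum_cons]
      simp only [ArithmeticFunction.map_zero, Int.cast_zero, zero_add]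
      refine Finset.sum_congr rfl fun k _ ↦ ?_
      rw [hr, hτ]; simp
    rw [h0, Complex.norm_intCast]
    linarith
  have hr0 : r ≠ 0 := by
    rw [hr, neg_ne_zero, mul_ne_zero_iff]; exact ⟨by exact_mod_cast hτ, I_ne_zero⟩
  rw [hsum, moebius_twist_abel hX hr0]
  -- norms
  have hnX : ‖((X : ℝ) : ℂ) ^ r‖ = 1 := by
    rw [Complex.norm_cpow_eq_rpow_re_of_pos (by exact_mod_cast hX) r]
    simp [hr]
  have hnorm : ∀ t ∈ Set.Ioc (1 : ℝ) X, ‖r * (t : ℂ) ^ (r - 1) * (mertensFunction t : ℂ)‖ =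
      |τ| * (|(mertensFunction t : ℝ)| / t) := by
    intro t ht
    have ht0 : 0 < t := by linarith [ht.1]
    rw [norm_mul, norm_mul, Complex.norm_cpow_eq_rpow_re_of_pos ht0, Complex.norm_intCast]
    have hre : (r - 1).re = -1 := by simp [hr]
    rw [hre, Real.rpow_neg_one, hr, norm_neg, norm_mul, Complex.norm_real, Complex.norm_I,
      mul_one, Real.norm_eq_abs]
    ring
  calc ‖((X : ℝ) : ℂ) ^ r * (mertensFunction X : ℂ) -
        ∫ t in Set.Ioc (1 : ℝ) X, r * (t : ℂ) ^ (r - 1) * (mertensFunction t : ℂ)‖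
      ≤ ‖((X : ℝ) : ℂ) ^ r * (mertensFunction X : ℂ)‖ +
        ‖∫ t in Set.Ioc (1 : ℝ) X, r * (t : ℂ) ^ (r - 1) * (mertensFunction t : ℂ)‖ := norm_sub_le _ _
    _ ≤ |(mertensFunction X : ℝ)| +
        ∫ t in Set.Ioc (1 : ℝ) X, ‖r * (t : ℂ) ^ (r - 1) * (mertensFunction t : ℂ)‖ := by
        refine add_le_add ?_ (norm_integral_le_integral_norm _)
        rw [norm_mul, hnX, one_mul, Complex.norm_intCast]
    _ = |(mertensFunction X : ℝ)| + |τ| * ∫ t in Set.Icc (1 : ℝ) X, |(mertensFunction t : ℝ)| / t := by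
        rw [setIntegral_congr_fun measurableSet_Ioc hnorm, integral_const_mul,
          integral_Icc_eq_integral_Ioc]

/-! ## `M(x) ≪ x^{1/2+η}` under RH, and the crude bound for `M_X(iτ)` -/

/-- Under RH, for every `η > 0`: `|M(x)| ≤ C x^{1/2+η}` for all `x ≥ 1` (the tree's
`M(x) = O(x^{1/2+η})`, Titchmarsh 14.25 (A) ⇒ (C), made uniform on `[1, ∞)` with `|M(x)| ≤ x`).
[cite: Titchmarsh1986, Thm 14.25] -/
lemma exists_abs_mertens_le_of_RH (hRH : RiemannHypothesis) {η : ℝ} (hη : 0 < η) :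
    ∃ C : ℝ, 0 < C ∧ ∀ x : ℝ, 1 ≤ x → |(mertensFunction x : ℝ)| ≤ C * x ^ (1 / 2 + η) := by
  obtain ⟨c, hc, h⟩ := Asymptotics.isBigO_iff'.mp
    (MertensBoundRH.mertens_isBigO_of_riemannHypothesis hRH hη)
  obtain ⟨x₀, hx₀⟩ := eventually_atTop.mp h
  set X₀ : ℝ := max x₀ 1 with hX₀
  refine ⟨max c X₀, lt_max_of_lt_left hc, fun x hx ↦ ?_⟩
  have hx0 : 0 < x := by linarith
  have hpow : 1 ≤ x ^ (1 / 2 + η) := Real.one_le_rpow hx (by linarith)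
  rcases le_or_gt X₀ x with hbig | hsmall
  · have := hx₀ x ((le_max_left _ _).trans hbig)
    rw [Real.norm_eq_abs, Real.norm_of_nonneg (by positivity)] at this
    exact this.trans (mul_le_mul_of_nonneg_right (le_max_left _ _) (by positivity))
  · calc |(mertensFunction x : ℝ)| ≤ x := abs_mertens_le hx0.le
      _ ≤ X₀ * 1 := by rw [mul_one]; exact hsmall.le
      _ ≤ max c X₀ * x ^ (1 / 2 + η) := mul_le_mul (le_max_right _ _) hpow zero_le_one (by positivity)

/-- `∫_1^X t^{p−1} dt ≤ X^p/p` for `p > 0`, `X ≥ 1` (set integral over `[1, X]`). [folklore] -/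
lemma setIntegral_rpow_sub_one_le {p : ℝ} (hp : 0 < p) {X : ℝ} (hX : 1 ≤ X) :
    ∫ t in Set.Icc (1 : ℝ) X, t ^ (p - 1) ≤ X ^ p / p := by
  rw [integral_Icc_eq_integral_Ioc, ← intervalIntegral.integral_of_le hX,
    integral_rpow (Or.inl (by linarith))]
  simp only [sub_add_cancel, Real.one_rpow]
  rw [div_le_div_iff_of_pos_right hp]
  linarith

/-- **`M_X(iτ) ≪ (1+|τ|)X^{1/2+η}` under RH** (`X ≥ 1`), by Prop. 11's partial summation from
`|M(x)| ≤ Cx^{1/2+η}`. [cite: BalazardDeRoton2010, Prop. 11 (with Titchmarsh 14.25 (C))] -/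
theorem exists_norm_moebiusSum_twist_le_of_RH (hRH : RiemannHypothesis) {η : ℝ} (hη : 0 < η) :
    ∃ C : ℝ, 0 < C ∧ ∀ X : ℕ, 1 ≤ X → ∀ τ : ℝ,
      ‖moebiusSum X (τ * I)‖ ≤ C * (1 + |τ|) * (X : ℝ) ^ (1 / 2 + η) := by
  obtain ⟨C, hC, hM⟩ := exists_abs_mertens_le_of_RH hRH hη
  refine ⟨C / (1 / 2 + η) + C, by positivity, fun X hX τ ↦ ?_⟩
  have hX1 : (1 : ℝ) ≤ X := by exact_mod_cast hX
  have hX0 : (0 : ℝ) < X := by linarith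
  refine (norm_moebiusSum_twist_le hX τ).trans ?_
  -- the integral
  have hint : ∫ t in Set.Icc (1 : ℝ) X, |(mertensFunction t : ℝ)| / t ≤
      C * ((X : ℝ) ^ (1 / 2 + η) / (1 / 2 + η)) := by
    calc ∫ t in Set.Icc (1 : ℝ) X, |(mertensFunction t : ℝ)| / t
        ≤ ∫ t in Set.Icc (1 : ℝ) X, C * t ^ (1 / 2 + η - 1) := by
          refine integral_mono_of_nonneg (ae_restrict_of_forall_mem measurableSet_Icc fun t ht ↦
            div_nonneg (abs_nonneg _) (by linarith [ht.1])) ?_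
            (ae_restrict_of_forall_mem measurableSet_Icc fun t ht ↦ ?_)
          · exact ((continuousOn_const.mul (ContinuousOn.rpow_const continuousOn_id
              fun t ht ↦ Or.inl (by simp only [id]; linarith [ht.1]))).integrableOn_Icc)
          · have ht0 : 0 < t := by linarith [ht.1]
            rw [div_le_iff₀ ht0, mul_assoc, ← Real.rpow_add_one ht0.ne']
            simpa using hM t ht.1
      _ = C * ∫ t in Set.Icc (1 : ℝ) X, t ^ (1 / 2 + η - 1) := integral_const_mul _ _
      _ ≤ C * ((X : ℝ) ^ (1 / 2 + η) / (1 / 2 + η)) := by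
          gcongr; exact setIntegral_rpow_sub_one_le (by linarith) hX1
  have hpow : 0 ≤ (X : ℝ) ^ (1 / 2 + η) := by positivity
  calc |(mertensFunction X : ℝ)| + |τ| * ∫ t in Set.Icc (1 : ℝ) X, |(mertensFunction t : ℝ)| / t
      ≤ C * (X : ℝ) ^ (1 / 2 + η) + |τ| * (C * ((X : ℝ) ^ (1 / 2 + η) / (1 / 2 + η))) := by
        gcongr; exact hM X hX1
    _ = (C + |τ| * (C / (1 / 2 + η))) * (X : ℝ) ^ (1 / 2 + η) := by ring
    _ ≤ (C / (1 / 2 + η) + C) * (1 + |τ|) * (X : ℝ) ^ (1 / 2 + η) := by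
        gcongr
        have h1 : 0 ≤ C / (1 / 2 + η) := by positivity
        nlinarith [abs_nonneg τ]

/-! ## Proposition 11: `M_N(iτ)` from a bound `|M(x)| ≤ C √x G(x)` -/

/-- **Balazard–de Roton 2010, Proposition 11 (partial summation, general form).** If
`|M(x)| ≤ C√x G(x)` for `x ≥ 1`, with `G ≥ 0` non-decreasing on `[1, ∞)`, then for `N ≥ 1` and all
real `τ`: `|M_N(iτ)| ≤ 2C(1+|τ|)√N G(N)`. (In the paper `G(x) = exp((log x)^{1/2}(log log x)^{5/2+δ})`,
Soundararajan's bound for `M(x)` under RH refined in [BR2008]; that input is not proved here.)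
[cite: BalazardDeRoton2010, Prop. 11] -/
theorem norm_moebiusSum_twist_le_of_mertens {C : ℝ} {G : ℝ → ℝ} (hC : 0 ≤ C)
    (hG0 : ∀ x : ℝ, 1 ≤ x → 0 ≤ G x) (hGm : MonotoneOn G (Set.Ici 1))
    (hM : ∀ x : ℝ, 1 ≤ x → |(mertensFunction x : ℝ)| ≤ C * Real.sqrt x * G x)
    {N : ℕ} (hN : 1 ≤ N) (τ : ℝ) :
    ‖moebiusSum N (τ * I)‖ ≤ 2 * C * (1 + |τ|) * Real.sqrt N * G N := by
  have hN1 : (1 : ℝ) ≤ N := by exact_mod_cast hN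
  have hN0 : (0 : ℝ) < N := by linarith
  have hGN : 0 ≤ G N := hG0 _ hN1
  refine (norm_moebiusSum_twist_le hN τ).trans ?_
  have hint : ∫ t in Set.Icc (1 : ℝ) N, |(mertensFunction t : ℝ)| / t ≤
      C * G N * (Real.sqrt N / (1 / 2)) := by
    calc ∫ t in Set.Icc (1 : ℝ) N, |(mertensFunction t : ℝ)| / t
        ≤ ∫ t in Set.Icc (1 : ℝ) N, C * G N * t ^ (1 / 2 - 1 : ℝ) := by
          refine integral_mono_of_nonneg (ae_restrict_of_forall_mem measurableSet_Icc fun t ht ↦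
            div_nonneg (abs_nonneg _) (by linarith [ht.1])) ?_
            (ae_restrict_of_forall_mem measurableSet_Icc fun t ht ↦ ?_)
          · exact ((continuousOn_const.mul (ContinuousOn.rpow_const continuousOn_id
              fun t ht ↦ Or.inl (by simp only [id]; linarith [ht.1]))).integrableOn_Icc)
          · have ht0 : 0 < t := by linarith [ht.1]
            have hGt : G t ≤ G N := hGm ht.1 (Set.mem_Ici.mpr hN1) ht.2
            rw [div_le_iff₀ ht0, mul_assoc, ← Real.rpow_add_one ht0.ne']
            norm_num
            rw [← Real.sqrt_eq_rpow]
            calc |(mertensFunction t : ℝ)| ≤ C * Real.sqrt t * G t := hM t ht.1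
              _ ≤ C * Real.sqrt t * G N := by gcongr
              _ = C * G N * Real.sqrt t := by ring
      _ = C * G N * ∫ t in Set.Icc (1 : ℝ) N, t ^ (1 / 2 - 1 : ℝ) := integral_const_mul _ _
      _ ≤ C * G N * ((N : ℝ) ^ (1 / 2 : ℝ) / (1 / 2)) :=
          mul_le_mul_of_nonneg_left (setIntegral_rpow_sub_one_le (by norm_num) hN1)
            (mul_nonneg hC hGN)
      _ = C * G N * (Real.sqrt N / (1 / 2)) := by rw [Real.sqrt_eq_rpow]
  calc |(mertensFunction N : ℝ)| + |τ| * ∫ t in Set.Icc (1 : ℝ) N, |(mertensFunction t : ℝ)| / t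
      ≤ C * Real.sqrt N * G N + |τ| * (C * G N * (Real.sqrt N / (1 / 2))) := by
        gcongr; exact hM N hN1
    _ = (1 + 2 * |τ|) * (C * Real.sqrt N * G N) := by ring
    _ ≤ (2 * (1 + |τ|)) * (C * Real.sqrt N * G N) :=
        mul_le_mul_of_nonneg_right (by linarith [abs_nonneg τ])
          (mul_nonneg (mul_nonneg hC (Real.sqrt_nonneg _)) hGN)
    _ = 2 * C * (1 + |τ|) * Real.sqrt N * G N := by ring

/-! ## Eq. (t61): the tail of `∑ μ(n) n^{-s}` by Abel summation -/

/-- `t ↦ M_{⌊t⌋}(iτ)` is measurable (a step function). [folklore] -/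
lemma measurable_moebiusSum_floor (τ : ℝ) :
    Measurable fun t : ℝ ↦ moebiusSum ⌊t⌋₊ (τ * I) :=
  (measurable_from_nat (f := fun k : ℕ ↦ moebiusSum k (τ * I))).comp Nat.measurable_floor

/-- The partial sums of `c(k) = μ(k)k^{-iτ}` are the twisted sums: `∑_{k=0}^{⌊t⌋} c(k) = M_{⌊t⌋}(iτ)`.
[folklore] -/
lemma sum_Icc_floor_twist_eq (t τ : ℝ) :
    ∑ k ∈ Icc 0 ⌊t⌋₊, (moebius k : ℂ) * ((k : ℝ) : ℂ) ^ (-((τ : ℂ) * I)) =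
      moebiusSum ⌊t⌋₊ (τ * I) := by
  rw [← sum_Icc_moebius_twist_eq]
  refine Finset.sum_congr rfl fun k _ ↦ by rw [Complex.ofReal_natCast]

/-- Under RH: `M_n(w) → 1/ζ(w)` (`n → ∞`) for `w = 1/2 + ε + iτ`, `0 < ε ≤ 1/4` (Littlewood,
Titchmarsh 14.25 (A); tree `baezDuarte_moebiusSum_approx_holds`). [cite: Titchmarsh1986, Thm 14.25] -/
lemma tendsto_moebiusSum_inv_zeta (hRH : RiemannHypothesis) {ε : ℝ} (hε : 0 < ε) (hε1 : ε ≤ 1 / 4)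
    (τ : ℝ) :
    Tendsto (fun n : ℕ ↦ moebiusSum n (1 / 2 + ε + τ * I)) atTop
      (𝓝 (riemannZeta (1 / 2 + ε + τ * I))⁻¹) := by
  have hzero : ∀ s : ℂ, 1 / 2 < s.re → riemannZeta s ≠ 0 :=
    (forall_riemannZeta_ne_zero_iff_quasiRiemannHypothesis _).2
      (quasiRiemannHypothesis_one_half_iff_holds.2 hRH)
  obtain ⟨C, hC⟩ := baezDuarte_moebiusSum_approx_holds (1 / 2) ε 1 le_rfl (by norm_num) hε
    one_pos hzero
  set w : ℂ := 1 / 2 + ε + τ * I with hw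
  have hwre : w.re = 1 / 2 + ε := by simp [hw]
  have hwim : w.im = τ := by simp [hw]
  have hw1 : w ≠ 1 := fun h ↦ by
    have := congrArg Complex.re h; rw [hwre, one_re] at this; linarith
  have hbound : ∀ n : ℕ, 2 ≤ n → ‖moebiusSum n w - (riemannZeta w)⁻¹‖ ≤
      C * (n : ℝ) ^ (-ε / 3) * (1 + |τ|) ^ (1 : ℝ) := by
    intro n hn
    have h := hC n w hn (by rw [hwre]) (by rw [hwre]; linarith) hw1
    rw [hwim, one_div (riemannZeta w)] at h
    exact h
  rw [tendsto_iff_norm_sub_tendsto_zero]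
  have hlim : Tendsto (fun n : ℕ ↦ C * (n : ℝ) ^ (-ε / 3) * (1 + |τ|) ^ (1 : ℝ)) atTop (𝓝 0) := by
    have h1 : Tendsto (fun n : ℕ ↦ (n : ℝ) ^ (-ε / 3)) atTop (𝓝 0) := by
      have := (tendsto_rpow_neg_atTop (by positivity : 0 < ε / 3)).comp tendsto_natCast_atTop_atTop
      refine this.congr fun n ↦ ?_
      simp only [Function.comp_apply, neg_div]
    have := (h1.const_mul C).mul_const ((1 + |τ|) ^ (1 : ℝ))
    simpa using this
  refine squeeze_zero' (Eventually.of_forall fun n ↦ norm_nonneg _)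
    (eventually_atTop.mpr ⟨2, fun n hn ↦ hbound n hn⟩) hlim

/-- **Balazard–de Roton 2010, eq. (t61)** (HR). For `N ≥ 1`, `0 < ε ≤ 1/4`, `τ ∈ ℝ`, with
`a = 1/2 + ε`, `w = a + iτ`:
`ζ(w)^{-1} − M_N(w) = −M_N(iτ) N^{-a} + a ∫_N^∞ t^{-a-1} M_{⌊t⌋}(iτ) dt`,
the integral converging absolutely (Abel summation of the tail of `∑ μ(n)n^{-w} = 1/ζ(w)`, which
converges under RH). [cite: BalazardDeRoton2010, §6.3 eq. (t61)] -/
theorem inv_zeta_sub_moebiusSum_eq (hRH : RiemannHypothesis) {N : ℕ} (hN : 1 ≤ N) {ε : ℝ}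
    (hε : 0 < ε) (hε1 : ε ≤ 1 / 4) (τ : ℝ) :
    IntegrableOn (fun t : ℝ ↦ (t : ℂ) ^ (-((1 / 2 + ε : ℝ) : ℂ) - 1) * moebiusSum ⌊t⌋₊ (τ * I))
        (Set.Ioi (N : ℝ)) ∧
      (riemannZeta (1 / 2 + ε + τ * I))⁻¹ - moebiusSum N (1 / 2 + ε + τ * I) =
        -(moebiusSum N (τ * I) * ((N : ℝ) : ℂ) ^ (-((1 / 2 + ε : ℝ) : ℂ))) +
          ((1 / 2 + ε : ℝ) : ℂ) * ∫ t in Set.Ioi (N : ℝ),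
            (t : ℂ) ^ (-((1 / 2 + ε : ℝ) : ℂ) - 1) * moebiusSum ⌊t⌋₊ (τ * I) := by
  set a : ℝ := 1 / 2 + ε with ha
  have ha0 : 0 < a := by positivity
  set w : ℂ := 1 / 2 + ε + τ * I with hw
  set r : ℂ := -((τ : ℂ) * I) with hr
  have hN1 : (1 : ℝ) ≤ N := by exact_mod_cast hN
  have hN0 : (0 : ℝ) < N := by linarith
  -- the crude RH bound for the twisted sums, `η = ε/2`
  obtain ⟨C, hC, hS⟩ := exists_norm_moebiusSum_twist_le_of_RH hRH (η := ε / 2) (by positivity)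
  set S : ℝ → ℂ := fun t ↦ moebiusSum ⌊t⌋₊ (τ * I) with hSdef
  have hSt : ∀ t : ℝ, 1 ≤ t → ‖S t‖ ≤ C * (1 + |τ|) * t ^ (1 / 2 + ε / 2) := by
    intro t ht
    have hft : 1 ≤ ⌊t⌋₊ := Nat.le_floor (by simpa using ht)
    refine (hS ⌊t⌋₊ hft τ).trans (mul_le_mul_of_nonneg_left (Real.rpow_le_rpow (Nat.cast_nonneg _)
      (Nat.floor_le (by linarith)) (by positivity)) (mul_nonneg hC.le (by positivity)))
  -- Step 0: the integrand `g(t) = t^{-a-1} S(t)` is integrable on `(N, ∞)`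
  set g : ℝ → ℂ := fun t ↦ (t : ℂ) ^ (-(a : ℂ) - 1) * S t with hg
  have hgm : Measurable g :=
    (Complex.measurable_ofReal.pow_const _).mul (measurable_moebiusSum_floor τ)
  have hnorm_cpow : ∀ t : ℝ, 0 < t → ‖(t : ℂ) ^ (-(a : ℂ) - 1)‖ = t ^ (-a - 1) := by
    intro t ht
    rw [Complex.norm_cpow_eq_rpow_re_of_pos ht]
    simp
  have hgi : IntegrableOn g (Set.Ioi (N : ℝ)) := by
    refine Integrable.mono' (((integrableOn_Ioi_rpow_of_lt (by linarith : -1 - ε / 2 < -1) hN0).const_mul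
      (C * (1 + |τ|)))) (hgm.aestronglyMeasurable) (ae_restrict_of_forall_mem measurableSet_Ioi ?_)
    intro t ht
    have ht1 : 1 ≤ t := hN1.trans (le_of_lt ht)
    have ht0 : 0 < t := by linarith
    simp only [hg, norm_mul, hnorm_cpow t ht0]
    calc t ^ (-a - 1) * ‖S t‖ ≤ t ^ (-a - 1) * (C * (1 + |τ|) * t ^ (1 / 2 + ε / 2)) :=
          mul_le_mul_of_nonneg_left (hSt t ht1) (Real.rpow_nonneg ht0.le _)
      _ = C * (1 + |τ|) * (t ^ (-a - 1) * t ^ (1 / 2 + ε / 2)) := by ring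
      _ = C * (1 + |τ|) * t ^ (-1 - ε / 2) := by
          rw [← Real.rpow_add ht0]; congr 2; rw [ha]; ring
  refine ⟨hgi, ?_⟩
  -- Step 1: Abel summation on `[N, X]`
  have hcoef : ∀ k : ℕ, 1 ≤ k → ((k : ℝ) : ℂ) ^ (-(a : ℂ)) * ((moebius k : ℂ) * ((k : ℝ) : ℂ) ^ r) =
      (moebius k : ℂ) / (k : ℂ) ^ w := by
    intro k hk
    have hk0 : ((k : ℝ) : ℂ) ≠ 0 := by exact_mod_cast (show k ≠ 0 by omega)
    have hprod : ((k : ℝ) : ℂ) ^ (-(a : ℂ)) * ((k : ℝ) : ℂ) ^ r = ((k : ℝ) : ℂ) ^ (-w) := by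
      rw [← cpow_add _ _ hk0]; congr 1; rw [hr, hw, ha]; push_cast; ring
    rw [div_eq_mul_inv, ← cpow_neg, ← Complex.ofReal_natCast, ← hprod]
    ring
  have habel : ∀ X : ℕ, N ≤ X → moebiusSum X w - moebiusSum N w =
      ((X : ℝ) : ℂ) ^ (-(a : ℂ)) * S X - ((N : ℝ) : ℂ) ^ (-(a : ℂ)) * S N -
        ∫ t in Set.Ioc (N : ℝ) X, (-(a : ℂ)) * (t : ℂ) ^ (-(a : ℂ) - 1) * S t := by
    intro X hNX
    have hdiff : ∀ t ∈ Set.Icc ((N : ℕ) : ℝ) ((X : ℕ) : ℝ),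
        DifferentiableAt ℝ (fun y : ℝ ↦ (y : ℂ) ^ (-(a : ℂ))) t := fun t ht ↦
      (hasDerivAt_ofReal_cpow_const (by linarith [ht.1]) (by
        rw [neg_ne_zero]; exact_mod_cast ha0.ne')).differentiableAt
    have hderiv_eq : ∀ t : ℝ, 0 < t → deriv (fun y : ℝ ↦ (y : ℂ) ^ (-(a : ℂ))) t =
        (-(a : ℂ)) * (t : ℂ) ^ (-(a : ℂ) - 1) := fun t ht ↦
      deriv_ofReal_cpow ht (by rw [neg_ne_zero]; exact_mod_cast ha0.ne')
    have hcont : ContinuousOn (fun t : ℝ ↦ (-(a : ℂ)) * (t : ℂ) ^ (-(a : ℂ) - 1))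
        (Set.Icc ((N : ℕ) : ℝ) ((X : ℕ) : ℝ)) := by
      refine continuousOn_const.mul (ContinuousOn.cpow_const (by fun_prop) fun t ht ↦ ?_)
      exact Or.inl (by simp; linarith [ht.1])
    have hint : IntegrableOn (deriv (fun y : ℝ ↦ (y : ℂ) ^ (-(a : ℂ))))
        (Set.Icc ((N : ℕ) : ℝ) ((X : ℕ) : ℝ)) :=
      (hcont.integrableOn_Icc).congr_fun (fun t ht ↦ (hderiv_eq t (by linarith [ht.1])).symm)
        measurableSet_Icc
    have h := sum_mul_eq_sub_sub_integral_mul' (fun k ↦ (moebius k : ℂ) * ((k : ℝ) : ℂ) ^ r)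
      hNX hdiff hint
    -- endpoint sums and the integrand
    have hSX : ∀ Y : ℕ, ∑ k ∈ Icc 0 Y, (moebius k : ℂ) * ((k : ℝ) : ℂ) ^ r = S Y := by
      intro Y
      simp only [hSdef, Nat.floor_natCast, hr]
      rw [← sum_Icc_moebius_twist_eq]
      exact Finset.sum_congr rfl fun k _ ↦ by rw [Complex.ofReal_natCast]
    rw [hSX X, hSX N] at h
    have hI : ∫ t in Set.Ioc (N : ℝ) X, deriv (fun y : ℝ ↦ (y : ℂ) ^ (-(a : ℂ))) t *
          ∑ k ∈ Icc 0 ⌊t⌋₊, (moebius k : ℂ) * ((k : ℝ) : ℂ) ^ r =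
        ∫ t in Set.Ioc (N : ℝ) X, (-(a : ℂ)) * (t : ℂ) ^ (-(a : ℂ) - 1) * S t := by
      refine setIntegral_congr_fun measurableSet_Ioc fun t ht ↦ ?_
      rw [hderiv_eq t (by linarith [ht.1]), hr, sum_Icc_floor_twist_eq]
    rw [hI] at h
    -- the left-hand side
    have hL : ∑ k ∈ Ioc N X, ((k : ℝ) : ℂ) ^ (-(a : ℂ)) * ((moebius k : ℂ) * ((k : ℝ) : ℂ) ^ r) =
        moebiusSum X w - moebiusSum N w := by
      rw [Finset.sum_congr rfl fun k hk ↦ hcoef k (by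
        have := (Finset.mem_Ioc.mp hk).1; omega)]
      have hIcc : ∀ Y : ℕ, moebiusSum Y w = ∑ k ∈ Ioc 0 Y, (moebius k : ℂ) / (k : ℂ) ^ w := by
        intro Y; unfold moebiusSum; congr 1
      rw [hIcc, hIcc, eq_sub_iff_add_eq, add_comm]
      exact Finset.sum_Ioc_consecutive (fun k ↦ (moebius k : ℂ) / (k : ℂ) ^ w) (Nat.zero_le N) hNX
    rw [← hL, h]
  -- Step 2: `X → ∞`
  have hlimL : Tendsto (fun X : ℕ ↦ moebiusSum X w - moebiusSum N w) atTop
      (𝓝 ((riemannZeta w)⁻¹ - moebiusSum N w)) :=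
    (tendsto_moebiusSum_inv_zeta hRH hε hε1 τ).sub_const _
  have hlim1 : Tendsto (fun X : ℕ ↦ ((X : ℝ) : ℂ) ^ (-(a : ℂ)) * S X) atTop (𝓝 0) := by
    rw [tendsto_zero_iff_norm_tendsto_zero]
    have hb : ∀ X : ℕ, 1 ≤ X → ‖((X : ℝ) : ℂ) ^ (-(a : ℂ)) * S X‖ ≤ C * (1 + |τ|) * (X : ℝ) ^ (-(ε / 2)) := by
      intro X hX
      have hX0 : (0 : ℝ) < X := by exact_mod_cast hX
      rw [norm_mul, Complex.norm_cpow_eq_rpow_re_of_pos hX0]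
      simp only [neg_re, ofReal_re]
      calc (X : ℝ) ^ (-a) * ‖S X‖ ≤ (X : ℝ) ^ (-a) * (C * (1 + |τ|) * (X : ℝ) ^ (1 / 2 + ε / 2)) :=
            mul_le_mul_of_nonneg_left (hSt X (by exact_mod_cast hX)) (Real.rpow_nonneg hX0.le _)
        _ = C * (1 + |τ|) * ((X : ℝ) ^ (-a) * (X : ℝ) ^ (1 / 2 + ε / 2)) := by ring
        _ = C * (1 + |τ|) * (X : ℝ) ^ (-(ε / 2)) := by
            rw [← Real.rpow_add hX0]; congr 2; rw [ha]; ring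
    have hlim : Tendsto (fun X : ℕ ↦ C * (1 + |τ|) * (X : ℝ) ^ (-(ε / 2))) atTop (𝓝 0) := by
      have := ((tendsto_rpow_neg_atTop (by positivity : 0 < ε / 2)).comp
        tendsto_natCast_atTop_atTop).const_mul (C * (1 + |τ|))
      simpa using this
    exact squeeze_zero' (Eventually.of_forall fun X ↦ norm_nonneg _)
      (eventually_atTop.mpr ⟨1, hb⟩) hlim
  have hlim2 : Tendsto (fun X : ℕ ↦ ∫ t in Set.Ioc (N : ℝ) X, (-(a : ℂ)) * (t : ℂ) ^ (-(a : ℂ) - 1) * S t)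
      atTop (𝓝 (∫ t in Set.Ioi (N : ℝ), (-(a : ℂ)) * (t : ℂ) ^ (-(a : ℂ) - 1) * S t)) := by
    have hgi' : IntegrableOn (fun t : ℝ ↦ (-(a : ℂ)) * (t : ℂ) ^ (-(a : ℂ) - 1) * S t) (Set.Ioi (N : ℝ)) := by
      have h0 : IntegrableOn (fun t : ℝ ↦ (-(a : ℂ)) * g t) (Set.Ioi (N : ℝ)) := hgi.const_mul (-(a : ℂ))
      refine h0.congr_fun (fun t _ ↦ ?_) measurableSet_Ioi
      simp only [hg]; ring
    have h := intervalIntegral_tendsto_integral_Ioi (N : ℝ) hgi' tendsto_natCast_atTop_atTop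
    refine h.congr' ?_
    filter_upwards [eventually_ge_atTop N] with X hX
    rw [intervalIntegral.integral_of_le (by exact_mod_cast hX)]
  have hlimR := (hlim1.sub_const (((N : ℝ) : ℂ) ^ (-(a : ℂ)) * S N)).sub hlim2
  have heq : (riemannZeta w)⁻¹ - moebiusSum N w =
      0 - ((N : ℝ) : ℂ) ^ (-(a : ℂ)) * S N -
        ∫ t in Set.Ioi (N : ℝ), (-(a : ℂ)) * (t : ℂ) ^ (-(a : ℂ) - 1) * S t := by
    refine tendsto_nhds_unique (hlimL.congr' ?_) hlimR
    filter_upwards [eventually_ge_atTop N] with X hX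
    exact habel X hX
  rw [heq]
  have hSN : S N = moebiusSum N (τ * I) := by simp only [hSdef, Nat.floor_natCast]
  have hI2 : ∫ t in Set.Ioi (N : ℝ), (-(a : ℂ)) * (t : ℂ) ^ (-(a : ℂ) - 1) * S t =
      (-(a : ℂ)) * ∫ t in Set.Ioi (N : ℝ), g t := by
    rw [← integral_const_mul]
    refine setIntegral_congr_fun measurableSet_Ioi fun t _ ↦ ?_
    simp only [hg]; ring
  rw [hSN, zero_sub, hI2]
  simp only [hg, hSdef]
  ring

end BalazardDeRoton

end Literature.NumberTheory.LFunctions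

end
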